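import Summits.MatrixMultiplication.OmegaCensus.SmallFormats.KroneckerCyclic

/-!
# Kronecker modules VI-c: companion blocks (Horner bases)

Cell `pub-omega` (unit `pub-omega-tensor-g33`), topic `Summits/MatrixMultiplication/OmegaCensus` (sub-folder `SmallFormats`).
Framing (verbatim): lottery ticket; floor = certified bounds/negative ranges. HONEST FRAMING: general linear algebra toward
PROVING `KroneckerBlockForm97`; nothing on `ω` here.

If `b : W → W'` is bijective, the Kronecker module `(a, b)` has a block decomposition into companion blocks `C c` in the
`PBlock` convention (`B = I`, `A` = companion matrix with subdiagonal ones and last column `-cᵢ`):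
`companion_blockDecomposition`. From the power-basis cyclic decomposition of `g = b⁻¹ a` (`KroneckerCyclic`) we pass to
the HORNER vectors `η_j = Σ_{t < D-j} c'_{t+j+1} w_t` (`c'_D = 1`), which satisfy `g η_{j+1} = η_j - c_{j+1} η_{D-1}`,
`g η_0 = -c_0 η_{D-1}`, `η_{D-1} = w_0` — exactly the column relations of the companion matrix.
-/

namespace Summit.MatrixMultiplication.OmegaCensus.SmallFormats.Kronecker

open Module Submodule

variable {k : Type*} [Field k]
variable {W W' : Type*} [AddCommGroup W] [Module k W] [AddCommGroup W'] [Module k W']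

/-- The row sums of a companion block: `Σ_{c<D} A j c • F c = -c_j • F (D-1) + F (j-1)` (`F (j-1)` absent for `j = 0`). -/
theorem sum_companion_row (D j : ℕ) (hj : j < D) (cj : k) (F : ℕ → W') :
    ∑ c ∈ Finset.range D, (if c + 1 = D then -cj else if j = c + 1 then (1 : k) else 0) • F c =
      -(cj • F (D - 1)) + if j = 0 then 0 else F (j - 1) := by
  obtain ⟨D', rfl⟩ : ∃ D', D = D' + 1 := ⟨D - 1, by omega⟩
  rw [Finset.sum_range_succ, if_pos rfl, Nat.add_sub_cancel, neg_smul, add_comm]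
  congr 1
  have hterm : ∀ c ∈ Finset.range D',
      (if c + 1 = D' + 1 then -cj else if j = c + 1 then (1 : k) else 0) • F c =
        (if c = j - 1 then (1 : k) else 0) • (if j = 0 then 0 else F c) := by
    intro c hc
    have hc' := Finset.mem_range.mp hc
    rw [if_neg (by omega)]
    by_cases h0 : j = 0
    · subst h0; simp
    · rw [if_neg h0]
      by_cases h : j = c + 1
      · rw [if_pos h, if_pos (by omega)]
      · rw [if_neg h, if_neg (by omega)]
  rw [Finset.sum_congr rfl hterm, sum_delta_smul]
  by_cases h0 : j = 0
  · simp [h0]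
  · rw [if_pos (by omega), if_neg h0]

variable [FiniteDimensional k W]

/-- **Companion-block decomposition.** If `b : W → W'` is bijective, `(a, b)` has a block decomposition into companion
blocks `C c` (`PBlock` convention), via Horner bases of the cyclic decomposition of `b⁻¹ a`. -/
theorem companion_blockDecomposition (a b : W →ₗ[k] W') (hb : Function.Bijective b) :
    ∃ (n : ℕ) (cs : Fin n → List k) (e : Fin n → ℕ → W) (f : Fin n → ℕ → W'),
      IsBlockDecomposition a b (fun i => KBlock.C (cs i)) e f := by
  classical
  set β := LinearEquiv.ofBijective b hb with hβ
  have hβb : ∀ x, β x = b x := fun x => rfl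
  let g : W →ₗ[k] W := β.symm.toLinearMap ∘ₗ a
  have hbg : ∀ x, b (g x) = a x := fun x => by
    show b (β.symm (a x)) = a x
    rw [← hβb, LinearEquiv.apply_symm_apply]
  obtain ⟨n, D, c, w, hcount, hspan, hgw, htop, -⟩ := cyclic_decomposition g
  -- extended coefficients: C' i (D i) = 1
  let C' : Fin n → ℕ → k := fun i m => if m < D i then c i m else 1
  have hC'lt : ∀ i m, m < D i → C' i m = c i m := fun i m hm => by simp [C', hm]
  have hC'D : ∀ i, C' i (D i) = 1 := fun i => by simp [C']
  -- Horner vectors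
  let η : Fin n → ℕ → W := fun i j => ∑ t ∈ Finset.range (D i - j), C' i (t + j + 1) • w i t
  have hη_last : ∀ i, 0 < D i → η i (D i - 1) = w i 0 := fun i hD => by
    simp only [η]
    rw [show D i - (D i - 1) = 1 by omega, Finset.sum_range_one, show 0 + (D i - 1) + 1 = D i by omega, hC'D, one_smul]
  have hgη_succ : ∀ i j, j + 1 < D i → g (η i (j + 1)) = η i j - c i (j + 1) • w i 0 := fun i j hj => by
    simp only [η, map_sum, map_smul, hgw]
    rw [show D i - j = (D i - (j + 1)) + 1 by omega, Finset.sum_range_succ', Nat.zero_add, hC'lt i _ hj]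
    simp_rw [show ∀ t, t + 1 + j + 1 = t + (j + 1) + 1 from fun t => by omega]
    simp
  have hgη_zero : ∀ i, 0 < D i → g (η i 0) = -(c i 0 • w i 0) := fun i hD => by
    obtain ⟨D', hD'⟩ : ∃ D', D i = D' + 1 := ⟨D i - 1, by omega⟩
    have hwD : w i (D' + 1) = -∑ m ∈ Finset.range (D' + 1), c i m • w i m := by
      rw [← hgw, ← hD']
      have := htop i
      rw [hD', Nat.add_sub_cancel] at this
      rw [hD']; exact this
    have hC1 : C' i (D' + 1) = 1 := by rw [← hD']; exact hC'D i
    simp only [η, map_sum, map_smul, hgw, Nat.sub_zero, Nat.add_zero]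
    rw [hD', Finset.sum_range_succ, hC1, one_smul, hwD, Finset.sum_range_succ']
    have : ∀ t ∈ Finset.range D', C' i (t + 1) • w i (t + 1) = c i (t + 1) • w i (t + 1) := fun t ht => by
      rw [hC'lt i _ (by have := Finset.mem_range.mp ht; omega)]
    rw [Finset.sum_congr rfl this]
    abel
  -- spanning: every w i t is in the span of the η's
  let F : (Σ i : Fin n, Fin (D i)) → W := fun p => η p.1 p.2
  have hwspan : ∀ i t, t < D i → w i t ∈ span k (Set.range F) := by
    intro i t
    induction t using Nat.strong_induction_on with
    | _ t ih =>
      intro ht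
      have hηt : η i (D i - 1 - t) = (∑ s ∈ Finset.range t, C' i (s + (D i - t)) • w i s) + w i t := by
        simp only [η]
        rw [show D i - (D i - 1 - t) = t + 1 by omega, Finset.sum_range_succ,
          show t + (D i - 1 - t) + 1 = D i by omega, hC'D, one_smul]
        congr 1
        exact Finset.sum_congr rfl (fun s hs => by
          have := Finset.mem_range.mp hs
          rw [show s + (D i - 1 - t) + 1 = s + (D i - t) by omega])
      have hmem : η i (D i - 1 - t) ∈ span k (Set.range F) :=
        subset_span ⟨⟨i, ⟨D i - 1 - t, by omega⟩⟩, rfl⟩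
      rw [hηt] at hmem
      have hsum : (∑ s ∈ Finset.range t, C' i (s + (D i - t)) • w i s) ∈ span k (Set.range F) :=
        Submodule.sum_mem _ (fun s hs => Submodule.smul_mem _ _ (ih s (Finset.mem_range.mp hs)
          (lt_trans (Finset.mem_range.mp hs) ht)))
      have := Submodule.sub_mem _ hmem hsum
      simpa using this
  let cs : Fin n → List k := fun i => List.ofFn (fun m : Fin (D i) => c i m)
  have hcs_len : ∀ i, (cs i).length = D i := fun i => by simp [cs]
  have hcs_get : ∀ i j, j < D i → (cs i).getD j 0 = c i j := fun i j hj => by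
    simp only [cs]
    rw [List.getD_eq_getElem _ _ (by simpa using hj), List.getElem_ofFn]
  refine ⟨n, cs, η, fun i j => b (η i j), ⟨?_, ?_, fun x => ?_, fun v => ?_, fun i j hj => ?_, fun i j hj => ?_⟩⟩
  · simp only [KBlock.rows, hcs_len]; exact hcount
  · simp only [KBlock.cols, hcs_len]; rw [← β.finrank_eq]; exact hcount
  · -- span of η
    have hx : x ∈ span k (Set.range F) := by
      obtain ⟨d, hd⟩ := hspan x
      rw [hd]
      exact Submodule.sum_mem _ (fun i _ => Submodule.sum_mem _ (fun j hj =>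
        Submodule.smul_mem _ _ (hwspan i j (Finset.mem_range.mp hj))))
    obtain ⟨cf, hcf⟩ := (Submodule.mem_span_range_iff_exists_fun k).mp hx
    refine ⟨fun i j => if h : j < D i then cf ⟨i, ⟨j, h⟩⟩ else 0, ?_⟩
    rw [← hcf, Fintype.sum_sigma]
    refine Finset.sum_congr rfl (fun i _ => ?_)
    simp only [KBlock.rows, hcs_len]
    rw [← Fin.sum_univ_eq_sum_range (fun j => (if h : j < D i then cf ⟨i, ⟨j, h⟩⟩ else 0) • η i j) (D i)]
    refine Finset.sum_congr rfl (fun j _ => ?_)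
    simp [F, j.2]
  · -- span of b η
    obtain ⟨d, hd⟩ := hspan (β.symm v)
    have hv : v = b (β.symm v) := by rw [← hβb, LinearEquiv.apply_symm_apply]
    have hx : β.symm v ∈ span k (Set.range F) := by
      rw [hd]
      exact Submodule.sum_mem _ (fun i _ => Submodule.sum_mem _ (fun j hj =>
        Submodule.smul_mem _ _ (hwspan i j (Finset.mem_range.mp hj))))
    obtain ⟨cf, hcf⟩ := (Submodule.mem_span_range_iff_exists_fun k).mp hx
    refine ⟨fun i j => if h : j < D i then cf ⟨i, ⟨j, h⟩⟩ else 0, ?_⟩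
    rw [hv, ← hcf, map_sum, Fintype.sum_sigma]
    refine Finset.sum_congr rfl (fun i _ => ?_)
    simp only [KBlock.cols, hcs_len]
    rw [← Fin.sum_univ_eq_sum_range (fun j => (if h : j < D i then cf ⟨i, ⟨j, h⟩⟩ else 0) • b (η i j)) (D i)]
    refine Finset.sum_congr rfl (fun j _ => ?_)
    simp [F, j.2, map_smul]
  · -- rel_a
    simp only [KBlock.rows, hcs_len] at hj
    simp only [KBlock.cols, KBlock.A, hcs_len, hcs_get i j hj]
    rw [sum_companion_row (D i) j hj, ← hbg]
    cases j with
    | zero => rw [hgη_zero i hj, ← hη_last i hj, if_pos rfl, add_zero, map_neg, map_smul]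
    | succ j' =>
        rw [hgη_succ i j' hj, ← hη_last i (by omega), if_neg (Nat.succ_ne_zero j'), Nat.succ_sub_one, map_sub,
          map_smul]
        abel
  · -- rel_b
    simp only [KBlock.rows, hcs_len] at hj
    simp only [KBlock.cols, KBlock.B, hcs_len, sum_delta_smul, if_pos hj]

end Summit.MatrixMultiplication.OmegaCensus.SmallFormats.Kronecker
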